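import Summits.QuantumFields.YangMills.Theorems.AtomicCalibrationRSmearedCompactness
import Summits.QuantumFields.YangMills.Theorems.InfiniteVolumeTranslations
import HarnessLib

/-!
# AtomicCalibrationR (stmt-QuantumFields-28169), B7 `stub_smearedIVData` — third brick: translation invariance on `⁰𝒮`, SMEARED bound
# (planner ym-idea-11 g15's `STUB-PLAN-smearedIVData.md`, step 7 (translations); prover w4 g23, free hands)

Verbatim twin of `InfiniteVolume.translateMulti_invariant_of_tendsto_oddTorusLimitPoints` with the pointwise collar (used there only
to produce the uniform bound on `⁰𝒮`, `norm_tsum_weight_mul_le`) REPLACED by the smeared bound itself: for a coupling sequence with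
`0 < a(β_k) ≤ 1/24`, `a(β_k) → 0`, states `μ_k ∈ oddTorusLimitPoints r β_k`, affine offsets `‖o k l‖ ≤ 5a(β_k)`, a subsequence
`φ`, a functional `S` to which the centred plane-string series converge on `⁰𝒮ₙ`, AND a uniform bound
`‖Σ'ₓ W_{μ_k}(q,x)·F(a(β_k)x + o k)‖ ≤ c·‖F‖_m` on `⁰𝒮ₙ`:  `S (translateMulti t F) = S F` for `t ∈ E4`, `F ∈ ⁰𝒮ₙ`
(`translateMulti_invariant_of_smeared`: the abstract `translate_eq_of_tendsto` + exact lattice invariance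
`tsum_weight_mul_translateMulti` / `infVolWeight_translate_oddTorusLimitPoints` + `exists_latticeVector_near`; the difference of two
translates of an off-diagonal test function IS off-diagonal, so the smeared bound controls the equicontinuity step).
`translateMulti_invariant_family_of_smeared` packages it for the one-field family `S₁ 0 = eval`, `S₁ 1 = 0`, `S₁ n = Σ_q T n q`.

HONEST FRAMING: soft analysis on HYPOTHESES; nothing about Bałaban's RG, a mass gap or Clay; no summit is proved. [folklore]
References: Glimm–Jaffe (1987) §6.1; Osterwalder–Schrader CMP 42 (1975) §4.
-/

set_option autoImplicit false

noncomputable section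

open scoped BigOperators SchwartzMap
open MeasureTheory Filter Topology
open Literature.MathematicalPhysics.QuantumFieldTheory hiding ZdEdge
open Literature.MathematicalPhysics.QuantumLattice
open Literature.MathematicalPhysics.AQFT
open Literature.Probability.LatticeModels (box Site)
open Summit.QuantumFields.YangMills.Cruxes.OSLegsFromFemtoAndGap.DlrCollarTransfer (plane exists_abs_plane_le)
open Summit.QuantumFields.YangMills.Theorems.InfiniteVolume (stateMomentStr abs_stateMomentStr_le summable_mul_of_bounded
  translate_eq_of_tendsto exists_latticeVector_near tsum_weight_mul_translateMulti infVolWeight_translate_oddTorusLimitPoints)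

namespace Summit.QuantumFields.YangMills.Cruxes.AtomicCalibrationR.SmearedTranslations

variable {G : Type} [Group G] [TopologicalSpace G] [IsTopologicalGroup G] [CompactSpace G]
  [MeasurableSpace G] [BorelSpace G]

/-- **TRANSLATION INVARIANCE OF THE LIMIT under a SMEARED bound.**  See the module docstring. [folklore] -/
theorem translateMulti_invariant_of_smeared (r : LatticeRep G) {a : ℝ → ℝ} (β : ℕ → ℝ) (ha : ∀ k, 0 < a (β k))
    (ha24 : ∀ k, a (β k) ≤ 1 / 24) (ha0 : Tendsto (fun k => a (β k)) atTop (𝓝 0))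
    (μ : ℕ → Measure (LGConfig 4 G)) (hμ : ∀ k, μ k ∈ oddTorusLimitPoints r (β k))
    {n : ℕ} (q : Fin n → Fin 4 × Fin 4) (o : ℕ → Fin n → EuclideanSpace ℝ (Fin 4)) (ho : ∀ k l, ‖o k l‖ ≤ 5 * a (β k))
    {c : ℝ} {m : ℕ}
    (hbd : ∀ (k : ℕ) (F : 𝓢((Fin n → EuclideanSpace ℝ (Fin 4)), ℂ)), IsOffDiagonal F →
      ‖∑' x : Fin n → Site 4, ((stateMomentStr G r (μ k) n q x : ℝ) : ℂ) * F (fun l => a (β k) • siteToE (x l) + o k l)‖ ≤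
        c * schwartzNorm m F)
    {φ : ℕ → ℕ} (hφ : StrictMono φ) (S : 𝓢((Fin n → EuclideanSpace ℝ (Fin 4)), ℂ) → ℂ)
    (hconv : ∀ F : 𝓢((Fin n → EuclideanSpace ℝ (Fin 4)), ℂ), IsOffDiagonal F →
      Tendsto (fun j => ∑' x : Fin n → Site 4, ((stateMomentStr G r (μ (φ j)) n q x : ℝ) : ℂ) *
        F (fun l => a (β (φ j)) • siteToE (x l) + o (φ j) l)) atTop (𝓝 (S F)))
    (t : EuclideanSpace ℝ (Fin 4)) (F : 𝓢((Fin n → EuclideanSpace ℝ (Fin 4)), ℂ)) (hF : IsOffDiagonal F) :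
    S (translateMulti t F) = S F := by
  obtain ⟨Cp, hCp⟩ := exists_abs_plane_le (G := G) r
  have hCp0 : 0 ≤ Cp := le_trans (abs_nonneg _) (hCp (0, 1) 0 (fun _ => 1))
  haveI : ∀ k, IsProbabilityMeasure (μ k) := fun k => by
    obtain ⟨S', -, hlim⟩ := hμ k
    exact hlim.1
  have ha1 : ∀ k, a (β k) ≤ 1 := fun k => (ha24 k).trans (by norm_num)
  have hsa : ∀ k, 6 * a (β k) ≤ 1 / 4 := fun k => by linarith [ha24 k]
  -- shorthand: weights, evaluation maps (as explicit lambdas)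
  have hyx : ∀ k (x : Fin n → Site 4) (l : Fin n),
      ‖(a (β k) • siteToE (x l) + o k l) - a (β k) • siteToE (x l)‖ ≤ 6 * a (β k) := fun k x l => by
    rw [add_sub_cancel_left]
    linarith [ho k l, (ha k).le]
  have hWsup : ∀ k (x : Fin n → Site 4), |stateMomentStr G r (μ k) n q x| ≤ (Cp + Cp) ^ n := fun k x =>
    abs_stateMomentStr_le r (μ k) hCp q x
  have hsum : ∀ j (F : 𝓢((Fin n → EuclideanSpace ℝ (Fin 4)), ℂ)),
      Summable fun x : Fin n → Site 4 => ((stateMomentStr G r (μ (φ j)) n q x : ℝ) : ℂ) *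
        F (fun l => a (β (φ j)) • siteToE (x l) + o (φ j) l) := fun j F =>
    summable_mul_of_bounded (ha (φ j)) (ha1 (φ j)) (hsa (φ j)) (pow_nonneg (by positivity) n)
      (fun x => stateMomentStr G r (μ (φ j)) n q x) (hWsup (φ j)) F (fun x l => a (β (φ j)) • siteToE (x l) + o (φ j) l)
      (hyx (φ j))
  have hsub : ∀ j (F G' : 𝓢((Fin n → EuclideanSpace ℝ (Fin 4)), ℂ)), IsOffDiagonal F → IsOffDiagonal G' →
      (∑' x : Fin n → Site 4, ((stateMomentStr G r (μ (φ j)) n q x : ℝ) : ℂ) *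
          (F - G') (fun l => a (β (φ j)) • siteToE (x l) + o (φ j) l)) =
        (∑' x : Fin n → Site 4, ((stateMomentStr G r (μ (φ j)) n q x : ℝ) : ℂ) *
            F (fun l => a (β (φ j)) • siteToE (x l) + o (φ j) l)) -
          ∑' x : Fin n → Site 4, ((stateMomentStr G r (μ (φ j)) n q x : ℝ) : ℂ) *
            G' (fun l => a (β (φ j)) • siteToE (x l) + o (φ j) l) := fun j F G' _ _ => by
    rw [← Summable.tsum_sub (hsum j F) (hsum j G')]
    exact tsum_congr fun x => by simp only [sub_apply]; ring
  -- lattice vectors approximating `t`, exact invariance along the sequence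
  have hv := fun j => exists_latticeVector_near (ha (φ j)) t
  choose v hv using hv
  have hbt : Tendsto (fun j => a (β (φ j)) • siteToE (v j)) atTop (𝓝 t) := by
    have ha0' : Tendsto (fun j => 2 * a (β (φ j))) atTop (𝓝 0) := by
      simpa using (ha0.comp hφ.tendsto_atTop).const_mul 2
    rw [tendsto_iff_norm_sub_tendsto_zero]
    refine squeeze_zero (fun j => norm_nonneg _) (fun j => ?_) ha0'
    rw [norm_sub_rev]; exact hv j
  have hinv : ∀ j (F : 𝓢((Fin n → EuclideanSpace ℝ (Fin 4)), ℂ)), IsOffDiagonal F →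
      (∑' x : Fin n → Site 4, ((stateMomentStr G r (μ (φ j)) n q x : ℝ) : ℂ) *
          translateMulti (a (β (φ j)) • siteToE (v j)) F (fun l => a (β (φ j)) • siteToE (x l) + o (φ j) l)) =
        ∑' x : Fin n → Site 4, ((stateMomentStr G r (μ (φ j)) n q x : ℝ) : ℂ) *
          F (fun l => a (β (φ j)) • siteToE (x l) + o (φ j) l) := fun j F _ =>
    tsum_weight_mul_translateMulti (fun x => stateMomentStr G r (μ (φ j)) n q x) (v j)
      (fun x => infVolWeight_translate_oddTorusLimitPoints r (hμ (φ j)) q x (v j)) _ (o (φ j)) F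
  exact translate_eq_of_tendsto
    (fun j F => ∑' x : Fin n → Site 4, ((stateMomentStr G r (μ (φ j)) n q x : ℝ) : ℂ) *
      F (fun l => a (β (φ j)) • siteToE (x l) + o (φ j) l))
    S hsub (fun j F hF' => hbd (φ j) F hF') hconv hbt hinv F hF

/-- **Translation invariance of the one-field family on `⁰𝒮`** for the smeared engine: with `S₁ 0 = eval`, `S₁ 1 = 0`,
`S₁ n = Σ_q T n q` (`n ≥ 2`), the centre-smeared series converging to `T n q` on `⁰𝒮` under the smeared bound, every `S₁ n` is
translation invariant on `⁰𝒮ₙ`. [folklore] -/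
theorem translateMulti_invariant_family_of_smeared (r : LatticeRep G) {a : ℝ → ℝ} (β : ℕ → ℝ) (ha : ∀ k, 0 < a (β k))
    (ha24 : ∀ k, a (β k) ≤ 1 / 24) (ha0 : Tendsto (fun k => a (β k)) atTop (𝓝 0))
    (μ : ℕ → Measure (LGConfig 4 G)) (hμ : ∀ k, μ k ∈ oddTorusLimitPoints r (β k))
    (S₁ : SchwingerFamily (EuclideanSpace ℝ (Fin 4)))
    (T : (n : ℕ) → (Fin n → Fin 4 × Fin 4) → (𝓢((Fin n → EuclideanSpace ℝ (Fin 4)), ℂ) →L[ℂ] ℂ))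
    (h0 : ∀ F : 𝓢((Fin 0 → EuclideanSpace ℝ (Fin 4)), ℂ), S₁ 0 F = F default)
    (h1 : ∀ F : 𝓢((Fin 1 → EuclideanSpace ℝ (Fin 4)), ℂ), S₁ 1 F = 0)
    (hS : ∀ n : ℕ, 2 ≤ n → ∀ F : 𝓢((Fin n → EuclideanSpace ℝ (Fin 4)), ℂ),
      S₁ n F = ∑ q ∈ Fintype.piFinset (fun _ : Fin n => Finset.univ.filter fun p : Fin 4 × Fin 4 => p.1 < p.2), T n q F)
    (c : ℕ → ℝ) (N : ℕ)
    (hbd : ∀ (k n : ℕ) (q : Fin n → Fin 4 × Fin 4), 2 ≤ n → (∀ i, (q i).1 < (q i).2) →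
      ∀ F : 𝓢((Fin n → EuclideanSpace ℝ (Fin 4)), ℂ), IsOffDiagonal F →
        ‖∑' x : Fin n → (Fin 4 → ℤ), ((stateMomentStr G r (μ k) n q x : ℝ) : ℂ) *
            F (fun l => a (β k) • siteToE (x l) +
              (a (β k) / 2) • (EuclideanSpace.single (q l).1 (1 : ℝ) + EuclideanSpace.single (q l).2 (1 : ℝ)))‖ ≤
          c n * schwartzNorm (N * n) F)
    (hT : ∀ n : ℕ, 2 ≤ n → ∀ q : Fin n → Fin 4 × Fin 4, (∀ i, (q i).1 < (q i).2) →
      ∀ F : 𝓢((Fin n → EuclideanSpace ℝ (Fin 4)), ℂ), IsOffDiagonal F →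
        Tendsto (fun k => ∑' x : Fin n → (Fin 4 → ℤ), ((stateMomentStr G r (μ k) n q x : ℝ) : ℂ) *
          F (fun l => a (β k) • siteToE (x l) +
            (a (β k) / 2) • (EuclideanSpace.single (q l).1 (1 : ℝ) + EuclideanSpace.single (q l).2 (1 : ℝ))))
          atTop (𝓝 (T n q F))) :
    ∀ (n : ℕ) (t : EuclideanSpace ℝ (Fin 4)) (F : 𝓢((Fin n → EuclideanSpace ℝ (Fin 4)), ℂ)), IsOffDiagonal F →
      S₁ n (translateMulti t F) = S₁ n F := by
  classical
  intro n t F hF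
  rcases Nat.lt_or_ge n 2 with hn | hn
  · interval_cases n
    · rw [h0, h0]
      exact (translateMulti_apply t F default).trans (congrArg F (Subsingleton.elim _ _))
    · rw [h1, h1]
  · rw [hS n hn, hS n hn]
    refine Finset.sum_congr rfl fun q hq => ?_
    have hq' : ∀ i, (q i).1 < (q i).2 := fun i => (Finset.mem_filter.1 ((Fintype.mem_piFinset.1 hq) i)).2
    exact translateMulti_invariant_of_smeared r β ha ha24 ha0 μ hμ q
      (fun k l => (a (β k) / 2) • (EuclideanSpace.single (q l).1 (1 : ℝ) + EuclideanSpace.single (q l).2 (1 : ℝ)))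
      (fun k l => Summit.QuantumFields.YangMills.Theorems.InfiniteVolume.norm_centreOffset_le (ha k).le (q l))
      (fun k F' hF' => hbd k n q hn hq' F' hF') strictMono_id (fun F' => T n q F') (fun F' hF' => hT n hn q hq' F' hF') t F hF

end Summit.QuantumFields.YangMills.Cruxes.AtomicCalibrationR.SmearedTranslations

end
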